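import Summits.HodgeConjecture.HodgeConjecture.Theorems.Ring2WeilCoverageCMFieldIrrationalRows
import Summits.HodgeConjecture.HodgeConjecture.Theorems.Ring2WeilCoverageCMFieldIrrationalRowsBiquadratic
import Summits.HodgeConjecture.HodgeConjecture.Theorems.Ring2WeilCoverageCMFieldIrrationalRowsBiquadraticSqrtFive
import HarnessLib

/-!
# Ring 2 — Weil-family coverage, CM-field rows: the `|T| = 4, 6` rows of the six Galois quartic tables
  that have NO RATIONAL MEMBER, in the kernel (WEIL-FAMILY-COVERAGE «## b03», cell (xv″))

research route conditional on HC_CM; not a corollary; Q11.4-sentence-2 already refuted in dim ≥ 3.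

For a quartic CM field `E ⊃ F = E⁺ = ℚ(√d)` the components of the `g = 8` Weil family of signature
`(2,2;2,2)` are indexed by Deligne's discriminant `δ ∈ F^×/Nm_{E/F}(E^×)` [cite: Deligne1982HodgeCycles, §4:
display (1) and Cor. 4.2 — p. 28 of the re-edition (J. Milne's TeX of LNM 900), LNM 900 pp. 49 ff.];
equivalently by the finite even sets `T` of places of `F` at which `δ` is not a local norm.  §b03.5 of the
census tabulates, for seven fields, the least representative of each of the `2⁵` classes `T ⊆ S6` (`S6` = the
first six non-split places); the `|T| ≤ 2` rows and the `|T| = 4` rows found in the box `|u₀|,|v₀| ≤ 60` are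
kernel-decided in `Ring2WeilCoverageCMFieldIrrationalRows{,Biquadratic,BiquadraticSqrtFive,NonGalois}`
(gen 57).  The remaining 78 classes received representatives in b03.25 P.S. (gen 60: box `≤ 400` + products,
×2 by PARI, kit j222434).  THIS FILE decides, for the six GALOIS fields, every one of those representatives
that has no rational member (63 rows): `[δ] ≠ [c]` for EVERY `c ∈ ℚ^×` — so the component `W8.E.[δ]` is
neither the split component nor any integer-indexed one —, each by ONE application of the landed
`(field, ℓ)`-level norm-parity theorems (`…_mk_ne_mk_ratCast_of_norm_ℓ`: a prime `ℓ` split in `F` with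
both places inert in `E/F`, or ramified in `F` and inert in `E/F`, dividing `N_{F/ℚ}(δ)` exactly once).
The representatives WITH a rational member (`ℚ(ζ₅)` {1,3,4,5} = [114], `ℚ(ζ₈)` {2,3,4,5} = [161],
`ℚ(ζ₁₂)` {3,4,5,6} = [253], `ℚ(√-3,√5)` {3,4,5,6} = [319], `ℚ(i,√5)` {2,3,4,5} = [209], `ℚ(√-(2+√2))`
{1,2,4,5} = [93], {1,3,4,5} = [155], {2,3,4,5} = [465]) are integer rows, classified by the fields' landed
prime/integer classifications; the non-Galois `D₄` field has a rational member on every `T ⊆ S6` (b03.22 (3)(b)).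

Conventions (= the landed files): `F = ℚ[S]/(R)`, `R = S² + pS + q`, `p² − 4q = f²d`, `√d = −(2σ + p)/f`,
so `a + b√d = (a − bp/f) + (−2b/f)σ`; a representative `δ ∉ ℤ[σ]` is replaced by `c²δ` (`c ∈ {2, 3}`), which
has the same class.  No new definition, no named fact, no sorry; every case is `exact <landed theorem> rfl u v w …`.
-/

noncomputable section

set_option linter.dupNamespace false

open Polynomial

namespace Summit.HodgeConjecture.HodgeConjecture.Ring2.WeilCoverageCM

open Literature.AlgebraicGeometry.Deligne1982
open Literature.AlgebraicGeometry.HodgeTheory (splitDiscriminantClassCM)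

/-! ### `E = ℚ(ζ₅)`: `R = S² + 5S + 5` (8 rows) -/

/-- **ℚ(ζ₅): the `|T| = 4, 6` rows of §b03.5 ∕ b03.25 P.S. (xv′) with NO RATIONAL MEMBER, in the kernel** —
for `R = X ^ 2 + C 5 * X + C 5` LITERALLY and each listed `(u, v)` (convention `√5 = −(2σ + 5)`; `(u, v)` = the representative
`δ = a + b√5` of b03.25 P.S. (xv′) written on `{1, σ}`, times the square shown when `δ ∉ ℤ[σ]`; `T` in the
`S6`-numbering of §b03.5 with the places named; `N = N_{F/ℚ}(u + vσ) = u² − 5uv + 5v²` and the engine prime):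
  `(126,-6)` = 141+3√5 — `T` = {1,3,4,6} = {(2,2), (3,3), (19,y - 10), (29,y - 11)}, `N` = 19836 = 19·1044;
  `(306,60)` = 156−30√5 — `T` = {1,3,5,6} = {(2,2), (3,3), (19,y - 9), (29,y - 11)}, `N` = 19836 = 19·1044;
  `(304,38)` = 209−19√5 — `T` = {1,4,5,6} = {(2,2), (19,y - 10), (19,y - 9), (29,y - 11)}, `N` = 41876 = 29·1444;
  `(63,-3)` = 141/2+3/2√5 — `T` = {2,3,4,6} = {(5,y), (3,3), (19,y - 10), (29,y - 11)}, `N` = 4959 = 19·261;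
  `(153,30)` = 78−15√5 — `T` = {2,3,5,6} = {(5,y), (3,3), (19,y - 9), (29,y - 11)}, `N` = 4959 = 19·261;
  `(152,19)` = 209/2−19/2√5 — `T` = {2,4,5,6} = {(5,y), (19,y - 10), (19,y - 9), (29,y - 11)}, `N` = 10469 = 29·361;
  `(456,57)` = 627/2−57/2√5 — `T` = {3,4,5,6} = {(3,3), (19,y - 10), (19,y - 9), (29,y - 11)}, `N` = 94221 = 29·3249;
  `(912,114)` = 627−57√5 — `T` = {1,2,3,4,5,6} = {(2,2), (5,y), (3,3), (19,y - 10), (19,y - 9), (29,y - 11)}, `N` = 376884 = 29·12996 (product representative)):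
the class `[u + vσ]` differs from `[c]` for EVERY `c ∈ ℚ^×`. [cite: Deligne1982HodgeCycles, §4 (1) and Cor. 4.2, p. 28 of the re-edition] -/
theorem zeta5_irrational_rows_box400 :
    haveI := fact_irreducible_realPolyQ_of_not_sq (R := X ^ 2 + C 5 * X + C 5) rfl disc_not_sq_five_five
    ∀ uv ∈ [((126 : ℤ), (-6 : ℤ)), (306, 60), (304, 38), (63, -3), (153, 30), (152, 19), (456, 57), (912, 114)],
      ∀ δ : (realField (X ^ 2 + C 5 * X + C 5))ˣ,
        (δ : realField (X ^ 2 + C 5 * X + C 5)) = AdjoinRoot.of (realPolyQ (X ^ 2 + C 5 * X + C 5)) (uv.1 : ℚ)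
            + AdjoinRoot.of (realPolyQ (X ^ 2 + C 5 * X + C 5)) (uv.2 : ℚ) * AdjoinRoot.root (realPolyQ (X ^ 2 + C 5 * X + C 5)) →
        ∀ (c : ℚ) (γ : (realField (X ^ 2 + C 5 * X + C 5))ˣ), (γ : realField (X ^ 2 + C 5 * X + C 5)) = (c : realField (X ^ 2 + C 5 * X + C 5)) →
          (QuotientGroup.mk δ : cmNormResidueGroup (X ^ 2 + C 5 * X + C 5)) ≠ QuotientGroup.mk γ := by
  haveI := fact_irreducible_realPolyQ_of_not_sq (R := X ^ 2 + C 5 * X + C 5) rfl disc_not_sq_five_five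
  intro uv huv δ hδ c γ hγ
  obtain ⟨u, v⟩ := uv
  simp only [List.mem_cons, Prod.mk.injEq, List.not_mem_nil, or_false] at huv
  rcases huv with ⟨rfl, rfl⟩ | ⟨rfl, rfl⟩ | ⟨rfl, rfl⟩ | ⟨rfl, rfl⟩ | ⟨rfl, rfl⟩ | ⟨rfl, rfl⟩ | ⟨rfl, rfl⟩ | ⟨rfl, rfl⟩
  · exact zeta5_mk_ne_mk_ratCast_of_norm_nineteen rfl 126 (-6) (1044) (by norm_num) (by norm_num) δ hδ c γ hγ
  · exact zeta5_mk_ne_mk_ratCast_of_norm_nineteen rfl 306 (60) (1044) (by norm_num) (by norm_num) δ hδ c γ hγ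
  · exact zeta5_mk_ne_mk_ratCast_of_norm_twentyNine rfl 304 (38) (1444) (by norm_num) (by norm_num) δ hδ c γ hγ
  · exact zeta5_mk_ne_mk_ratCast_of_norm_nineteen rfl 63 (-3) (261) (by norm_num) (by norm_num) δ hδ c γ hγ
  · exact zeta5_mk_ne_mk_ratCast_of_norm_nineteen rfl 153 (30) (261) (by norm_num) (by norm_num) δ hδ c γ hγ
  · exact zeta5_mk_ne_mk_ratCast_of_norm_twentyNine rfl 152 (19) (361) (by norm_num) (by norm_num) δ hδ c γ hγ
  · exact zeta5_mk_ne_mk_ratCast_of_norm_twentyNine rfl 456 (57) (3249) (by norm_num) (by norm_num) δ hδ c γ hγ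
  · exact zeta5_mk_ne_mk_ratCast_of_norm_twentyNine rfl 912 (114) (12996) (by norm_num) (by norm_num) δ hδ c γ hγ

/-! ### `E = ℚ(√-(2+√2))`: `R = S² + 4S + 2` (13 rows) -/

/-- **ℚ(√-(2+√2)): the `|T| = 4, 6` rows of §b03.5 ∕ b03.25 P.S. (xv′) with NO RATIONAL MEMBER, in the kernel** —
for `R = X ^ 2 + C 4 * X + C 2` LITERALLY and each listed `(u, v)` (convention `√2 = −(2σ + 4)/2`; `(u, v)` = the representative
`δ = a + b√2` of b03.25 P.S. (xv′) written on `{1, σ}`, times the square shown when `δ ∉ ℤ[σ]`; `T` in the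
`S6`-numbering of §b03.5 with the places named; `N = N_{F/ℚ}(u + vσ) = u² − 4uv + 2v²` and the engine prime):
  `(15,-45)` = 105+45√2 — `T` = {1,2,3,4} = {(2,y), (3,3), (5,5), (31,y - 8)}, `N` = 6975 = 31·225;
  `(195,45)` = 105−45√2 — `T` = {1,2,3,5} = {(2,y), (3,3), (5,5), (31,y + 8)}, `N` = 6975 = 31·225;
  `(45,-30)` = 105+30√2 — `T` = {1,2,3,6} = {(2,y), (3,3), (5,5), (41,y - 17)}, `N` = 9225 = 41·225;
  `(231,51)` = 129−51√2 — `T` = {1,2,4,6} = {(2,y), (3,3), (31,y - 8), (41,y - 17)}, `N` = 11439 = 31·369;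
  `(153,21)` = 111−21√2 — `T` = {1,2,5,6} = {(2,y), (3,3), (31,y + 8), (41,y - 17)}, `N` = 11439 = 31·369;
  `(385,85)` = 215−85√2 — `T` = {1,3,4,6} = {(2,y), (5,5), (31,y - 8), (41,y - 17)}, `N` = 31775 = 31·1025;
  `(255,35)` = 185−35√2 — `T` = {1,3,5,6} = {(2,y), (5,5), (31,y + 8), (41,y - 17)}, `N` = 31775 = 31·1025;
  `(93,-62)` = 217+62√2 — `T` = {1,4,5,6} = {(2,y), (31,y - 8), (31,y + 8), (41,y - 17)}, `N` = 39401 = 41·961;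
  `(1155,255)` = 645−255√2 — `T` = {2,3,4,6} = {(3,3), (5,5), (31,y - 8), (41,y - 17)}, `N` = 285975 = 31·9225 (product representative);
  `(765,105)` = 555−105√2 — `T` = {2,3,5,6} = {(3,3), (5,5), (31,y + 8), (41,y - 17)}, `N` = 285975 = 31·9225 (product representative);
  `(279,-186)` = 651+186√2 — `T` = {2,4,5,6} = {(3,3), (31,y - 8), (31,y + 8), (41,y - 17)}, `N` = 354609 = 41·8649 (product representative);
  `(465,-310)` = 1085+310√2 — `T` = {3,4,5,6} = {(5,5), (31,y - 8), (31,y + 8), (41,y - 17)}, `N` = 985025 = 41·24025 (product representative);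
  `(1395,-930)` = 3255+930√2 — `T` = {1,2,3,4,5,6} = {(2,y), (3,3), (5,5), (31,y - 8), (31,y + 8), (41,y - 17)}, `N` = 8865225 = 41·216225 (product representative)):
the class `[u + vσ]` differs from `[c]` for EVERY `c ∈ ℚ^×`. [cite: Deligne1982HodgeCycles, §4 (1) and Cor. 4.2, p. 28 of the re-edition] -/
theorem sqrtNegTwoPlusSqrtTwo_irrational_rows_box400 :
    haveI := fact_irreducible_realPolyQ_of_not_sq (R := X ^ 2 + C 4 * X + C 2) rfl disc_not_sq_four_two
    ∀ uv ∈ [((15 : ℤ), (-45 : ℤ)), (195, 45), (45, -30), (231, 51), (153, 21), (385, 85), (255, 35), (93, -62), (1155, 255), (765, 105), (279, -186), (465, -310), (1395, -930)],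
      ∀ δ : (realField (X ^ 2 + C 4 * X + C 2))ˣ,
        (δ : realField (X ^ 2 + C 4 * X + C 2)) = AdjoinRoot.of (realPolyQ (X ^ 2 + C 4 * X + C 2)) (uv.1 : ℚ)
            + AdjoinRoot.of (realPolyQ (X ^ 2 + C 4 * X + C 2)) (uv.2 : ℚ) * AdjoinRoot.root (realPolyQ (X ^ 2 + C 4 * X + C 2)) →
        ∀ (c : ℚ) (γ : (realField (X ^ 2 + C 4 * X + C 2))ˣ), (γ : realField (X ^ 2 + C 4 * X + C 2)) = (c : realField (X ^ 2 + C 4 * X + C 2)) →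
          (QuotientGroup.mk δ : cmNormResidueGroup (X ^ 2 + C 4 * X + C 2)) ≠ QuotientGroup.mk γ := by
  haveI := fact_irreducible_realPolyQ_of_not_sq (R := X ^ 2 + C 4 * X + C 2) rfl disc_not_sq_four_two
  intro uv huv δ hδ c γ hγ
  obtain ⟨u, v⟩ := uv
  simp only [List.mem_cons, Prod.mk.injEq, List.not_mem_nil, or_false] at huv
  rcases huv with ⟨rfl, rfl⟩ | ⟨rfl, rfl⟩ | ⟨rfl, rfl⟩ | ⟨rfl, rfl⟩ | ⟨rfl, rfl⟩ | ⟨rfl, rfl⟩ | ⟨rfl, rfl⟩ | ⟨rfl, rfl⟩ | ⟨rfl, rfl⟩ | ⟨rfl, rfl⟩ | ⟨rfl, rfl⟩ | ⟨rfl, rfl⟩ | ⟨rfl, rfl⟩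
  · exact sqrtNegTwoPlusSqrtTwo_mk_ne_mk_ratCast_of_norm_thirtyOne rfl 15 (-45) (225) (by norm_num) (by norm_num) δ hδ c γ hγ
  · exact sqrtNegTwoPlusSqrtTwo_mk_ne_mk_ratCast_of_norm_thirtyOne rfl 195 (45) (225) (by norm_num) (by norm_num) δ hδ c γ hγ
  · exact sqrtNegTwoPlusSqrtTwo_mk_ne_mk_ratCast_of_norm_fortyOne rfl 45 (-30) (225) (by norm_num) (by norm_num) δ hδ c γ hγ
  · exact sqrtNegTwoPlusSqrtTwo_mk_ne_mk_ratCast_of_norm_thirtyOne rfl 231 (51) (369) (by norm_num) (by norm_num) δ hδ c γ hγ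
  · exact sqrtNegTwoPlusSqrtTwo_mk_ne_mk_ratCast_of_norm_thirtyOne rfl 153 (21) (369) (by norm_num) (by norm_num) δ hδ c γ hγ
  · exact sqrtNegTwoPlusSqrtTwo_mk_ne_mk_ratCast_of_norm_thirtyOne rfl 385 (85) (1025) (by norm_num) (by norm_num) δ hδ c γ hγ
  · exact sqrtNegTwoPlusSqrtTwo_mk_ne_mk_ratCast_of_norm_thirtyOne rfl 255 (35) (1025) (by norm_num) (by norm_num) δ hδ c γ hγ
  · exact sqrtNegTwoPlusSqrtTwo_mk_ne_mk_ratCast_of_norm_fortyOne rfl 93 (-62) (961) (by norm_num) (by norm_num) δ hδ c γ hγ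
  · exact sqrtNegTwoPlusSqrtTwo_mk_ne_mk_ratCast_of_norm_thirtyOne rfl 1155 (255) (9225) (by norm_num) (by norm_num) δ hδ c γ hγ
  · exact sqrtNegTwoPlusSqrtTwo_mk_ne_mk_ratCast_of_norm_thirtyOne rfl 765 (105) (9225) (by norm_num) (by norm_num) δ hδ c γ hγ
  · exact sqrtNegTwoPlusSqrtTwo_mk_ne_mk_ratCast_of_norm_fortyOne rfl 279 (-186) (8649) (by norm_num) (by norm_num) δ hδ c γ hγ
  · exact sqrtNegTwoPlusSqrtTwo_mk_ne_mk_ratCast_of_norm_fortyOne rfl 465 (-310) (24025) (by norm_num) (by norm_num) δ hδ c γ hγ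
  · exact sqrtNegTwoPlusSqrtTwo_mk_ne_mk_ratCast_of_norm_fortyOne rfl 1395 (-930) (216225) (by norm_num) (by norm_num) δ hδ c γ hγ

/-! ### `E = ℚ(ζ₈) = ℚ(i,√2)`: `R = S² + 6S + 1` (12 rows) -/

/-- **ℚ(ζ₈) = ℚ(i,√2): the `|T| = 4, 6` rows of §b03.5 ∕ b03.25 P.S. (xv′) with NO RATIONAL MEMBER, in the kernel** —
for `R = X ^ 2 + C 6 * X + C 1` LITERALLY and each listed `(u, v)` (convention `√2 = −(2σ + 6)/4`; `(u, v)` = the representative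
`δ = a + b√2` of b03.25 P.S. (xv′) written on `{1, σ}`, times the square shown when `δ ∉ ℤ[σ]`; `T` in the
`S6`-numbering of §b03.5 with the places named; `N = N_{F/ℚ}(u + vσ) = u² − 6uv + 1v²` and the engine prime):
  `(414,46)` = 4·(69−23√2) — `T` = {1,2,4,5} = {(2,y), (7,y - 3), (23,y - 5), (23,y + 5)}, `N` = 59248 = 7·8464;
  `(314,10)` = 4·(71−5√2) — `T` = {1,2,4,6} = {(2,y), (7,y - 3), (23,y - 5), (31,y - 8)}, `N` = 79856 = 7·11408;
  `(166,-50)` = 4·(79+25√2) — `T` = {1,2,5,6} = {(2,y), (7,y - 3), (23,y + 5), (31,y - 8)}, `N` = 79856 = 7·11408;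
  `(138,-46)` = 4·(69+23√2) — `T` = {1,3,4,5} = {(2,y), (7,y + 3), (23,y - 5), (23,y + 5)}, `N` = 59248 = 7·8464;
  `(670,94)` = 4·(97−47√2) — `T` = {1,3,4,6} = {(2,y), (7,y + 3), (23,y - 5), (31,y - 8)}, `N` = 79856 = 7·11408;
  `(370,26)` = 4·(73−13√2) — `T` = {1,3,5,6} = {(2,y), (7,y + 3), (23,y + 5), (31,y - 8)}, `N` = 79856 = 7·11408;
  `(230,-138)` = 4·(161+69√2) — `T` = {1,4,5,6} = {(2,y), (23,y - 5), (23,y + 5), (31,y - 8)}, `N` = 262384 = 31·8464;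
  `(119,-28)` = 203+56√2 — `T` = {2,3,4,6} = {(7,y - 3), (7,y + 3), (23,y - 5), (31,y - 8)}, `N` = 34937 = 23·1519;
  `(413,56)` = 245−112√2 — `T` = {2,3,5,6} = {(7,y - 3), (7,y + 3), (23,y + 5), (31,y - 8)}, `N` = 34937 = 23·1519;
  `(276,-23)` = 345+46√2 — `T` = {2,4,5,6} = {(7,y - 3), (23,y - 5), (23,y + 5), (31,y - 8)}, `N` = 114793 = 7·16399;
  `(598,69)` = 391−138√2 — `T` = {3,4,5,6} = {(7,y + 3), (23,y - 5), (23,y + 5), (31,y - 8)}, `N` = 114793 = 7·16399;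
  `(1610,-966)` = 4·(1127+483√2) — `T` = {1,2,3,4,5,6} = {(2,y), (7,y - 3), (7,y + 3), (23,y - 5), (23,y + 5), (31,y - 8)}, `N` = 12856816 = 31·414736 (product representative)):
the class `[u + vσ]` differs from `[c]` for EVERY `c ∈ ℚ^×`. [cite: Deligne1982HodgeCycles, §4 (1) and Cor. 4.2, p. 28 of the re-edition] -/
theorem zeta8_irrational_rows_box400 :
    haveI := fact_irreducible_realPolyQ_of_not_sq (R := X ^ 2 + C 6 * X + C 1) rfl disc_not_sq_six_one
    ∀ uv ∈ [((414 : ℤ), (46 : ℤ)), (314, 10), (166, -50), (138, -46), (670, 94), (370, 26), (230, -138), (119, -28), (413, 56), (276, -23), (598, 69), (1610, -966)],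
      ∀ δ : (realField (X ^ 2 + C 6 * X + C 1))ˣ,
        (δ : realField (X ^ 2 + C 6 * X + C 1)) = AdjoinRoot.of (realPolyQ (X ^ 2 + C 6 * X + C 1)) (uv.1 : ℚ)
            + AdjoinRoot.of (realPolyQ (X ^ 2 + C 6 * X + C 1)) (uv.2 : ℚ) * AdjoinRoot.root (realPolyQ (X ^ 2 + C 6 * X + C 1)) →
        ∀ (c : ℚ) (γ : (realField (X ^ 2 + C 6 * X + C 1))ˣ), (γ : realField (X ^ 2 + C 6 * X + C 1)) = (c : realField (X ^ 2 + C 6 * X + C 1)) →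
          (QuotientGroup.mk δ : cmNormResidueGroup (X ^ 2 + C 6 * X + C 1)) ≠ QuotientGroup.mk γ := by
  haveI := fact_irreducible_realPolyQ_of_not_sq (R := X ^ 2 + C 6 * X + C 1) rfl disc_not_sq_six_one
  intro uv huv δ hδ c γ hγ
  obtain ⟨u, v⟩ := uv
  simp only [List.mem_cons, Prod.mk.injEq, List.not_mem_nil, or_false] at huv
  rcases huv with ⟨rfl, rfl⟩ | ⟨rfl, rfl⟩ | ⟨rfl, rfl⟩ | ⟨rfl, rfl⟩ | ⟨rfl, rfl⟩ | ⟨rfl, rfl⟩ | ⟨rfl, rfl⟩ | ⟨rfl, rfl⟩ | ⟨rfl, rfl⟩ | ⟨rfl, rfl⟩ | ⟨rfl, rfl⟩ | ⟨rfl, rfl⟩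
  · exact zeta8_mk_ne_mk_ratCast_of_norm_seven rfl 414 (46) (8464) (by norm_num) (by norm_num) δ hδ c γ hγ
  · exact zeta8_mk_ne_mk_ratCast_of_norm_seven rfl 314 (10) (11408) (by norm_num) (by norm_num) δ hδ c γ hγ
  · exact zeta8_mk_ne_mk_ratCast_of_norm_seven rfl 166 (-50) (11408) (by norm_num) (by norm_num) δ hδ c γ hγ
  · exact zeta8_mk_ne_mk_ratCast_of_norm_seven rfl 138 (-46) (8464) (by norm_num) (by norm_num) δ hδ c γ hγ
  · exact zeta8_mk_ne_mk_ratCast_of_norm_seven rfl 670 (94) (11408) (by norm_num) (by norm_num) δ hδ c γ hγ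
  · exact zeta8_mk_ne_mk_ratCast_of_norm_seven rfl 370 (26) (11408) (by norm_num) (by norm_num) δ hδ c γ hγ
  · exact zeta8_mk_ne_mk_ratCast_of_norm_thirtyOne rfl 230 (-138) (8464) (by norm_num) (by norm_num) δ hδ c γ hγ
  · exact zeta8_mk_ne_mk_ratCast_of_norm_twentyThree rfl 119 (-28) (1519) (by norm_num) (by norm_num) δ hδ c γ hγ
  · exact zeta8_mk_ne_mk_ratCast_of_norm_twentyThree rfl 413 (56) (1519) (by norm_num) (by norm_num) δ hδ c γ hγ
  · exact zeta8_mk_ne_mk_ratCast_of_norm_seven rfl 276 (-23) (16399) (by norm_num) (by norm_num) δ hδ c γ hγ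
  · exact zeta8_mk_ne_mk_ratCast_of_norm_seven rfl 598 (69) (16399) (by norm_num) (by norm_num) δ hδ c γ hγ
  · exact zeta8_mk_ne_mk_ratCast_of_norm_thirtyOne rfl 1610 (-966) (414736) (by norm_num) (by norm_num) δ hδ c γ hγ

/-! ### `E = ℚ(ζ₁₂) = ℚ(i,√3)`: `R = S² + 8S + 4` (10 rows) -/

/-- **ℚ(ζ₁₂) = ℚ(i,√3): the `|T| = 4, 6` rows of §b03.5 ∕ b03.25 P.S. (xv′) with NO RATIONAL MEMBER, in the kernel** —
for `R = X ^ 2 + C 8 * X + C 4` LITERALLY and each listed `(u, v)` (convention `√3 = −(2σ + 8)/4`; `(u, v)` = the representative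
`δ = a + b√3` of b03.25 P.S. (xv′) written on `{1, σ}`, times the square shown when `δ ∉ ℤ[σ]`; `T` in the
`S6`-numbering of §b03.5 with the places named; `N = N_{F/ℚ}(u + vσ) = u² − 8uv + 4v²` and the engine prime):
  `(92,-46)` = 4·(69+23√3) — `T` = {1,2,5,6} = {(2,y + 1), (3,y), (23,y - 7), (23,y + 7)}, `N` = 50784 = 3·16928;
  `(396,22)` = 4·(77−11√3) — `T` = {1,3,4,5} = {(2,y + 1), (11,y - 5), (11,y + 5), (23,y - 7)}, `N` = 89056 = 23·3872;
  `(220,-22)` = 4·(77+11√3) — `T` = {1,3,4,6} = {(2,y + 1), (11,y - 5), (11,y + 5), (23,y + 7)}, `N` = 89056 = 23·3872;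
  `(644,46)` = 4·(115−23√3) — `T` = {1,3,5,6} = {(2,y + 1), (11,y - 5), (23,y - 7), (23,y + 7)}, `N` = 186208 = 11·16928;
  `(276,-46)` = 4·(115+23√3) — `T` = {1,4,5,6} = {(2,y + 1), (11,y + 5), (23,y - 7), (23,y + 7)}, `N` = 186208 = 11·16928;
  `(55,-11)` = 99+22√3 — `T` = {2,3,4,5} = {(3,y), (11,y - 5), (11,y + 5), (23,y - 7)}, `N` = 8349 = 3·2783;
  `(143,11)` = 99−22√3 — `T` = {2,3,4,6} = {(3,y), (11,y - 5), (11,y + 5), (23,y + 7)}, `N` = 8349 = 3·2783;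
  `(368,-46)` = 4·(138+23√3) — `T` = {2,3,5,6} = {(3,y), (11,y - 5), (23,y - 7), (23,y + 7)}, `N` = 279312 = 3·93104;
  `(736,46)` = 4·(138−23√3) — `T` = {2,4,5,6} = {(3,y), (11,y + 5), (23,y - 7), (23,y + 7)}, `N` = 279312 = 3·93104;
  `(1012,-506)` = 4·(759+253√3) — `T` = {1,2,3,4,5,6} = {(2,y + 1), (3,y), (11,y - 5), (11,y + 5), (23,y - 7), (23,y + 7)}, `N` = 6144864 = 3·2048288 (product representative)):
the class `[u + vσ]` differs from `[c]` for EVERY `c ∈ ℚ^×`. [cite: Deligne1982HodgeCycles, §4 (1) and Cor. 4.2, p. 28 of the re-edition] -/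
theorem zeta12_irrational_rows_box400 :
    haveI := fact_irreducible_realPolyQ_of_not_sq (R := X ^ 2 + C 8 * X + C 4) rfl disc_not_sq_eight_four
    ∀ uv ∈ [((92 : ℤ), (-46 : ℤ)), (396, 22), (220, -22), (644, 46), (276, -46), (55, -11), (143, 11), (368, -46), (736, 46), (1012, -506)],
      ∀ δ : (realField (X ^ 2 + C 8 * X + C 4))ˣ,
        (δ : realField (X ^ 2 + C 8 * X + C 4)) = AdjoinRoot.of (realPolyQ (X ^ 2 + C 8 * X + C 4)) (uv.1 : ℚ)
            + AdjoinRoot.of (realPolyQ (X ^ 2 + C 8 * X + C 4)) (uv.2 : ℚ) * AdjoinRoot.root (realPolyQ (X ^ 2 + C 8 * X + C 4)) →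
        ∀ (c : ℚ) (γ : (realField (X ^ 2 + C 8 * X + C 4))ˣ), (γ : realField (X ^ 2 + C 8 * X + C 4)) = (c : realField (X ^ 2 + C 8 * X + C 4)) →
          (QuotientGroup.mk δ : cmNormResidueGroup (X ^ 2 + C 8 * X + C 4)) ≠ QuotientGroup.mk γ := by
  haveI := fact_irreducible_realPolyQ_of_not_sq (R := X ^ 2 + C 8 * X + C 4) rfl disc_not_sq_eight_four
  intro uv huv δ hδ c γ hγ
  obtain ⟨u, v⟩ := uv
  simp only [List.mem_cons, Prod.mk.injEq, List.not_mem_nil, or_false] at huv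
  rcases huv with ⟨rfl, rfl⟩ | ⟨rfl, rfl⟩ | ⟨rfl, rfl⟩ | ⟨rfl, rfl⟩ | ⟨rfl, rfl⟩ | ⟨rfl, rfl⟩ | ⟨rfl, rfl⟩ | ⟨rfl, rfl⟩ | ⟨rfl, rfl⟩ | ⟨rfl, rfl⟩
  · exact zeta12_mk_ne_mk_ratCast_of_norm_three rfl 92 (-46) (16928) (by norm_num) (by norm_num) δ hδ c γ hγ
  · exact zeta12_mk_ne_mk_ratCast_of_norm_twentyThree rfl 396 (22) (3872) (by norm_num) (by norm_num) δ hδ c γ hγ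
  · exact zeta12_mk_ne_mk_ratCast_of_norm_twentyThree rfl 220 (-22) (3872) (by norm_num) (by norm_num) δ hδ c γ hγ
  · exact zeta12_mk_ne_mk_ratCast_of_norm_eleven rfl 644 (46) (16928) (by norm_num) (by norm_num) δ hδ c γ hγ
  · exact zeta12_mk_ne_mk_ratCast_of_norm_eleven rfl 276 (-46) (16928) (by norm_num) (by norm_num) δ hδ c γ hγ
  · exact zeta12_mk_ne_mk_ratCast_of_norm_three rfl 55 (-11) (2783) (by norm_num) (by norm_num) δ hδ c γ hγ
  · exact zeta12_mk_ne_mk_ratCast_of_norm_three rfl 143 (11) (2783) (by norm_num) (by norm_num) δ hδ c γ hγ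
  · exact zeta12_mk_ne_mk_ratCast_of_norm_three rfl 368 (-46) (93104) (by norm_num) (by norm_num) δ hδ c γ hγ
  · exact zeta12_mk_ne_mk_ratCast_of_norm_three rfl 736 (46) (93104) (by norm_num) (by norm_num) δ hδ c γ hγ
  · exact zeta12_mk_ne_mk_ratCast_of_norm_three rfl 1012 (-506) (2048288) (by norm_num) (by norm_num) δ hδ c γ hγ

/-! ### `E = ℚ(√-3,√5)`: `R = S² + 9S + 9` (9 rows) -/

/-- **ℚ(√-3,√5): the `|T| = 4, 6` rows of §b03.5 ∕ b03.25 P.S. (xv′) with NO RATIONAL MEMBER, in the kernel** —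
for `R = X ^ 2 + C 9 * X + C 9` LITERALLY and each listed `(u, v)` (convention `√5 = −(2σ + 9)/3`; `(u, v)` = the representative
`δ = a + b√5` of b03.25 P.S. (xv′) written on `{1, σ}`, times the square shown when `δ ∉ ℤ[σ]`; `T` in the
`S6`-numbering of §b03.5 with the places named; `N = N_{F/ℚ}(u + vσ) = u² − 9uv + 9v²` and the engine prime):
  `(261,-87)` = 9·(145/2+29/2√5) — `T` = {1,2,5,6} = {(5,y), (3,3), (29,y - 11), (29,y + 11)}, `N` = 340605 = 5·68121;
  `(88,-11)` = 275/2+33/2√5 — `T` = {1,3,4,5} = {(5,y), (11,y - 4), (11,y + 4), (29,y - 11)}, `N` = 17545 = 5·3509;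
  `(187,11)` = 275/2−33/2√5 — `T` = {1,3,4,6} = {(5,y), (11,y - 4), (11,y + 4), (29,y + 11)}, `N` = 17545 = 5·3509;
  `(2349,87)` = 9·(435/2−29/2√5) — `T` = {1,3,5,6} = {(5,y), (11,y - 4), (29,y - 11), (29,y + 11)}, `N` = 3746655 = 5·749331;
  `(1566,-87)` = 9·(435/2+29/2√5) — `T` = {1,4,5,6} = {(5,y), (11,y + 4), (29,y - 11), (29,y + 11)}, `N` = 3746655 = 5·749331;
  `(396,-33)` = 9·(121/2+11/2√5) — `T` = {2,3,4,6} = {(3,3), (11,y - 4), (11,y + 4), (29,y + 11)}, `N` = 284229 = 29·9801;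
  `(522,-87)` = 9·(203/2+29/2√5) — `T` = {2,3,5,6} = {(3,3), (11,y - 4), (29,y - 11), (29,y + 11)}, `N` = 749331 = 11·68121;
  `(1305,87)` = 9·(203/2−29/2√5) — `T` = {2,4,5,6} = {(3,3), (11,y + 4), (29,y - 11), (29,y + 11)}, `N` = 749331 = 11·68121;
  `(2871,-957)` = 9·(1595/2+319/2√5) — `T` = {1,2,3,4,5,6} = {(5,y), (3,3), (11,y - 4), (11,y + 4), (29,y - 11), (29,y + 11)}, `N` = 41213205 = 5·8242641 (product representative)):
the class `[u + vσ]` differs from `[c]` for EVERY `c ∈ ℚ^×`. [cite: Deligne1982HodgeCycles, §4 (1) and Cor. 4.2, p. 28 of the re-edition] -/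
theorem sqrtNeg3Sqrt5_irrational_rows_box400 :
    haveI := fact_irreducible_realPolyQ_of_not_sq (R := X ^ 2 + C 9 * X + C 9) rfl disc_not_sq_nine_nine
    ∀ uv ∈ [((261 : ℤ), (-87 : ℤ)), (88, -11), (187, 11), (2349, 87), (1566, -87), (396, -33), (522, -87), (1305, 87), (2871, -957)],
      ∀ δ : (realField (X ^ 2 + C 9 * X + C 9))ˣ,
        (δ : realField (X ^ 2 + C 9 * X + C 9)) = AdjoinRoot.of (realPolyQ (X ^ 2 + C 9 * X + C 9)) (uv.1 : ℚ)
            + AdjoinRoot.of (realPolyQ (X ^ 2 + C 9 * X + C 9)) (uv.2 : ℚ) * AdjoinRoot.root (realPolyQ (X ^ 2 + C 9 * X + C 9)) →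
        ∀ (c : ℚ) (γ : (realField (X ^ 2 + C 9 * X + C 9))ˣ), (γ : realField (X ^ 2 + C 9 * X + C 9)) = (c : realField (X ^ 2 + C 9 * X + C 9)) →
          (QuotientGroup.mk δ : cmNormResidueGroup (X ^ 2 + C 9 * X + C 9)) ≠ QuotientGroup.mk γ := by
  haveI := fact_irreducible_realPolyQ_of_not_sq (R := X ^ 2 + C 9 * X + C 9) rfl disc_not_sq_nine_nine
  intro uv huv δ hδ c γ hγ
  obtain ⟨u, v⟩ := uv
  simp only [List.mem_cons, Prod.mk.injEq, List.not_mem_nil, or_false] at huv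
  rcases huv with ⟨rfl, rfl⟩ | ⟨rfl, rfl⟩ | ⟨rfl, rfl⟩ | ⟨rfl, rfl⟩ | ⟨rfl, rfl⟩ | ⟨rfl, rfl⟩ | ⟨rfl, rfl⟩ | ⟨rfl, rfl⟩ | ⟨rfl, rfl⟩
  · exact sqrtNeg3Sqrt5_mk_ne_mk_ratCast_of_norm_five rfl 261 (-87) (68121) (by norm_num) (by norm_num) δ hδ c γ hγ
  · exact sqrtNeg3Sqrt5_mk_ne_mk_ratCast_of_norm_five rfl 88 (-11) (3509) (by norm_num) (by norm_num) δ hδ c γ hγ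
  · exact sqrtNeg3Sqrt5_mk_ne_mk_ratCast_of_norm_five rfl 187 (11) (3509) (by norm_num) (by norm_num) δ hδ c γ hγ
  · exact sqrtNeg3Sqrt5_mk_ne_mk_ratCast_of_norm_five rfl 2349 (87) (749331) (by norm_num) (by norm_num) δ hδ c γ hγ
  · exact sqrtNeg3Sqrt5_mk_ne_mk_ratCast_of_norm_five rfl 1566 (-87) (749331) (by norm_num) (by norm_num) δ hδ c γ hγ
  · exact sqrtNeg3Sqrt5_mk_ne_mk_ratCast_of_norm_twentyNine rfl 396 (-33) (9801) (by norm_num) (by norm_num) δ hδ c γ hγ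
  · exact sqrtNeg3Sqrt5_mk_ne_mk_ratCast_of_norm_eleven rfl 522 (-87) (68121) (by norm_num) (by norm_num) δ hδ c γ hγ
  · exact sqrtNeg3Sqrt5_mk_ne_mk_ratCast_of_norm_eleven rfl 1305 (87) (68121) (by norm_num) (by norm_num) δ hδ c γ hγ
  · exact sqrtNeg3Sqrt5_mk_ne_mk_ratCast_of_norm_five rfl 2871 (-957) (8242641) (by norm_num) (by norm_num) δ hδ c γ hγ

/-! ### `E = ℚ(i,√5)`: `R = S² + 3S + 1` (11 rows) -/

/-- **ℚ(i,√5): the `|T| = 4, 6` rows of §b03.5 ∕ b03.25 P.S. (xv′) with NO RATIONAL MEMBER, in the kernel** —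
for `R = X ^ 2 + C 3 * X + C 1` LITERALLY and each listed `(u, v)` (convention `√5 = −(2σ + 3)`; `(u, v)` = the representative
`δ = a + b√5` of b03.25 P.S. (xv′) written on `{1, σ}`, times the square shown when `δ ∉ ℤ[σ]`; `T` in the
`S6`-numbering of §b03.5 with the places named; `N = N_{F/ℚ}(u + vσ) = u² − 3uv + 1v²` and the engine prime):
  `(38,-19)` = 133/2+19/2√5 — `T` = {1,2,4,5} = {(2,2), (11,y - 4), (19,y - 10), (19,y - 9)}, `N` = 3971 = 11·361;
  `(61,-14)` = 82+7√5 — `T` = {1,2,4,6} = {(2,2), (11,y - 4), (19,y - 10), (31,y - 6)}, `N` = 6479 = 11·589;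
  `(119,23)` = 169/2−23/2√5 — `T` = {1,2,5,6} = {(2,2), (11,y - 4), (19,y - 9), (31,y - 6)}, `N` = 6479 = 11·589;
  `(142,35)` = 179/2−35/2√5 — `T` = {1,3,4,6} = {(2,2), (11,y + 4), (19,y - 10), (31,y - 6)}, `N` = 6479 = 11·589;
  `(82,1)` = 161/2−1/2√5 — `T` = {1,3,5,6} = {(2,2), (11,y + 4), (19,y - 9), (31,y - 6)}, `N` = 6479 = 11·589;
  `(171,38)` = 114−19√5 — `T` = {1,4,5,6} = {(2,2), (19,y - 10), (19,y - 9), (31,y - 6)}, `N` = 11191 = 31·361;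
  `(319,33)` = 539/2−33/2√5 — `T` = {2,3,4,6} = {(11,y - 4), (11,y + 4), (19,y - 10), (31,y - 6)}, `N` = 71269 = 19·3751;
  `(165,-77)` = 561/2+77/2√5 — `T` = {2,3,5,6} = {(11,y - 4), (11,y + 4), (19,y - 9), (31,y - 6)}, `N` = 71269 = 19·3751;
  `(380,19)` = 703/2−19/2√5 — `T` = {2,4,5,6} = {(11,y - 4), (19,y - 10), (19,y - 9), (31,y - 6)}, `N` = 123101 = 11·11191;
  `(247,-76)` = 361+38√5 — `T` = {3,4,5,6} = {(11,y + 4), (19,y - 10), (19,y - 9), (31,y - 6)}, `N` = 123101 = 11·11191;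
  `(1881,418)` = 1254−209√5 — `T` = {1,2,3,4,5,6} = {(2,2), (11,y - 4), (11,y + 4), (19,y - 10), (19,y - 9), (31,y - 6)}, `N` = 1354111 = 31·43681 (product representative)):
the class `[u + vσ]` differs from `[c]` for EVERY `c ∈ ℚ^×`. [cite: Deligne1982HodgeCycles, §4 (1) and Cor. 4.2, p. 28 of the re-edition] -/
theorem sqrtNeg1Sqrt5_irrational_rows_box400 :
    haveI := fact_irreducible_realPolyQ_of_not_sq (R := X ^ 2 + C 3 * X + C 1) rfl disc_not_sq_three_one
    ∀ uv ∈ [((38 : ℤ), (-19 : ℤ)), (61, -14), (119, 23), (142, 35), (82, 1), (171, 38), (319, 33), (165, -77), (380, 19), (247, -76), (1881, 418)],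
      ∀ δ : (realField (X ^ 2 + C 3 * X + C 1))ˣ,
        (δ : realField (X ^ 2 + C 3 * X + C 1)) = AdjoinRoot.of (realPolyQ (X ^ 2 + C 3 * X + C 1)) (uv.1 : ℚ)
            + AdjoinRoot.of (realPolyQ (X ^ 2 + C 3 * X + C 1)) (uv.2 : ℚ) * AdjoinRoot.root (realPolyQ (X ^ 2 + C 3 * X + C 1)) →
        ∀ (c : ℚ) (γ : (realField (X ^ 2 + C 3 * X + C 1))ˣ), (γ : realField (X ^ 2 + C 3 * X + C 1)) = (c : realField (X ^ 2 + C 3 * X + C 1)) →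
          (QuotientGroup.mk δ : cmNormResidueGroup (X ^ 2 + C 3 * X + C 1)) ≠ QuotientGroup.mk γ := by
  haveI := fact_irreducible_realPolyQ_of_not_sq (R := X ^ 2 + C 3 * X + C 1) rfl disc_not_sq_three_one
  intro uv huv δ hδ c γ hγ
  obtain ⟨u, v⟩ := uv
  simp only [List.mem_cons, Prod.mk.injEq, List.not_mem_nil, or_false] at huv
  rcases huv with ⟨rfl, rfl⟩ | ⟨rfl, rfl⟩ | ⟨rfl, rfl⟩ | ⟨rfl, rfl⟩ | ⟨rfl, rfl⟩ | ⟨rfl, rfl⟩ | ⟨rfl, rfl⟩ | ⟨rfl, rfl⟩ | ⟨rfl, rfl⟩ | ⟨rfl, rfl⟩ | ⟨rfl, rfl⟩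
  · exact sqrtNeg1Sqrt5_mk_ne_mk_ratCast_of_norm_eleven rfl 38 (-19) (361) (by norm_num) (by norm_num) δ hδ c γ hγ
  · exact sqrtNeg1Sqrt5_mk_ne_mk_ratCast_of_norm_eleven rfl 61 (-14) (589) (by norm_num) (by norm_num) δ hδ c γ hγ
  · exact sqrtNeg1Sqrt5_mk_ne_mk_ratCast_of_norm_eleven rfl 119 (23) (589) (by norm_num) (by norm_num) δ hδ c γ hγ
  · exact sqrtNeg1Sqrt5_mk_ne_mk_ratCast_of_norm_eleven rfl 142 (35) (589) (by norm_num) (by norm_num) δ hδ c γ hγ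
  · exact sqrtNeg1Sqrt5_mk_ne_mk_ratCast_of_norm_eleven rfl 82 (1) (589) (by norm_num) (by norm_num) δ hδ c γ hγ
  · exact sqrtNeg1Sqrt5_mk_ne_mk_ratCast_of_norm_thirtyOne rfl 171 (38) (361) (by norm_num) (by norm_num) δ hδ c γ hγ
  · exact sqrtNeg1Sqrt5_mk_ne_mk_ratCast_of_norm_nineteen rfl 319 (33) (3751) (by norm_num) (by norm_num) δ hδ c γ hγ
  · exact sqrtNeg1Sqrt5_mk_ne_mk_ratCast_of_norm_nineteen rfl 165 (-77) (3751) (by norm_num) (by norm_num) δ hδ c γ hγ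
  · exact sqrtNeg1Sqrt5_mk_ne_mk_ratCast_of_norm_eleven rfl 380 (19) (11191) (by norm_num) (by norm_num) δ hδ c γ hγ
  · exact sqrtNeg1Sqrt5_mk_ne_mk_ratCast_of_norm_eleven rfl 247 (-76) (11191) (by norm_num) (by norm_num) δ hδ c γ hγ
  · exact sqrtNeg1Sqrt5_mk_ne_mk_ratCast_of_norm_thirtyOne rfl 1881 (418) (43681) (by norm_num) (by norm_num) δ hδ c γ hγ

end Summit.HodgeConjecture.HodgeConjecture.Ring2.WeilCoverageCM

end
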